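import Summits.QuantumFields.BalabanUV.Beta.RowD1JointEnd
import Summits.QuantumFields.BalabanUV.Beta.BorderLetterPacking

/-!
# `BalabanUV.Beta.WardLettersUnpacking` — binder row D1, «WX4»: **THE ENTRYWISE (BOND-LEVEL) FORM OF THE hW WARD LETTERS OF THE ROW
# LITERAL `JsRowD1`** — `hBord0` ∕ `hBord0''` (border table `vh₂SAn1`) and `hM₂0` (mixed table `mixFFAt`) of K-Q
# `RowD1JointEnd.symmetries_JsRowD1_of_letters` (β sub-cell, D1 formalisation swarm, leaf-05 gen 7)

HONEST FRAMING (cell charter, verbatim): «discharging BetaPertH makes Balaban's UV stability UNCONDITIONAL — a real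
constructive-QFT result; it is NOT the continuum limit and NOT the Clay problem.»
HONEST DEPENDENCY: continuum YM on T⁴ ⇐ BetaPertH ∧ nine spine estimates (0/9 proved); BetaPertH ⇐ (D1) ∧ (D4) ∧ CAP+tail;
G-an2-4 gates asym, D1 and NE2/3/4.
DERIVED cell leaf ([folklore] unfolding over node 7aρ∕12b tables, an5's packer, an2's K-N∕K-Q vocabulary and leaf-06's Ward-letter SHAPES,
all BY NAME).  BOTH sides of every implication are hypothesis SHAPES (nothing is asserted to hold); no statement of Bałaban's papers, no
`[cite:]`, no definition, no `Prop` fact.  Proves NO Ward identity and NO letter; 0∕4 binders (hW, hR, D1Tel, D1Rep).  NOT D1, NOT BetaPertH,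
NOT continuum, NOT Clay.

## What is here (`ρ_c = toSite (ctrOff 4 Lc)`, `y_v := Lc•Y + toSite v`, block bond `b = (m, blk z)`, fluctuation bond `f = (β, x)`)
* §1 entries: `divV_sum_apply` (the block-summed jet-slot divergence, entrywise), `legSum_inl/_inr` (the gauge-rotation symbol
  `Σ_v legInd ρ_c y_v` on a field ∕ multiplier leg = `#{v : x = y_v}` ∕ `#{v : z + ρ_c = y_v}`).
* §2 **`hBord0_of_bondWard`**: the border Ward letter in the FIRST jet slot for `vh₂SAn1` (K-Q's `hBord0` TOKEN FOR TOKEN, any `cB`) FROM the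
  displayed bond-level identity `hW` on the field–multiplier entries (the multiplier–field block follows by the anti-twin ∕ twin symmetries,
  the diagonal blocks vanish): `(Lc⁴)⁻¹·cB·Σ_{v,κ} (Ssym_b(f; (κ, y_v − e_κ), h) − Ssym_b(f; (κ, y_v), h)) = cVH·m_b(f,h)·(½Σ_v[z + ρ_c = y_v] − ½Σ_v[x = y_v])`
  (`cVH = −Lc⁸∕2`; at lockB `cB = −Lc¹²∕4` the coefficient `cVH·Lc⁴∕cB·½… ` makes this the unit-coefficient gauge-covariance identity).
* §3 **`hBord0''_of_bondWard`**: the same in the SECOND jet slot (by `vh₂SAn1_swap` it is §2's identity with the roles of the jet bonds exchanged).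
* §4 **`hM₂0_of_bondWard`**: the mixed Ward letter for `mixFFAt` with residual `RW₀` FROM the field–field scalar identity
  `(Lc⁴)⁻¹·Σ_{v,κ} (t_b(f,f′;(κ,y_v−e_κ)) − t_b(f,f′;(κ,y_v))) = cΛ·h_b(f,f′)·(½Σ_v[z = y_v] − ½Σ_v[x = y_v]) + RW₀-entry` (+ `RW₀` ff-supported).
Provenance: β sub-cell, D1 formalisation swarm, unit b2b-balaban-beta-d1-formalise-leaf-05 gen 7, 2026-08-20 (v1); no existing file touched.
-/

open Finset
open scoped BigOperators
open Literature.MathematicalPhysics.QuantumFieldTheory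
open Literature.MathematicalPhysics.QuantumFieldTheory.Balaban1983to89
open Literature.MathematicalPhysics.QuantumFieldTheory.Balaban1983to89.Beta
open ExpKernelCalculus (MKer comp)
open KernelWard (divV)
open AffineAveraging (box toSite)
open AveragingContours (blk off)
open AveragingContoursRooted (ctr ctrOff)
open AveragingHessianKernels (Bond packVH packVH_inl_inr packVH_inr_inl packVH_inl_inl packVH_inr_inr)
open AveragingHessianKernelsRooted (vhKerAt linKerAt hessKerAt vhSAt vhSAt_symm hessFFAt hessFFAt_inl_inl hessFFAt_inl_inr hessFFAt_inr)
open AveragingMixedJetTables (vh2KerAt vh₂SAt mixKerAt mixFFAt mixFFAt_inl_inl mixFFAt_inl_inr mixFFAt_inr)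
open BalabanStepJetsSucc (wVH)
open BalabanStepW2 (M2Of wM1 wM2)
open Summit.QuantumFields.BalabanUV.Beta.SpineRooted (M1At)
open OneStepResolventKernel (Fib)
open B6BondElimination (unitVec)
open Summit.QuantumFields.BalabanUV.Beta.TameKernelCalculus
open Summit.QuantumFields.BalabanUV.Beta.BorderedHessian (diagK stepScale comp_diagK_left comp_diagK_right)
open Summit.QuantumFields.BalabanUV.Beta.AveragingWardRootedStencils (legInd legInd_inl legInd_inr)
open Summit.QuantumFields.BalabanUV.Beta.SecondOrderSocketIdentification (vh₂SAn1 vh₂SAn1_inl_inl vh₂SAn1_inr_inr vh₂SAn1_antiTwin vh₂SAn1_swap)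
open Summit.QuantumFields.BalabanUV.Beta.BorderLetterPacking (vhSAt_inl_inr' vh₂SAn1_inl_inr)

namespace Summit.QuantumFields.BalabanUV.Beta.WardLettersUnpacking

noncomputable section

variable {Lc : ℕ}

/-! ## §1 Entries of the block-summed divergence and of the gauge-rotation symbol -/

/-- [folklore] The block-summed divergence of a jet-bond family, entrywise. -/
theorem divV_sum_apply (F : Fin 4 → (Fin 4 → ℤ) → MKer 4 (Fib 3)) (Y : Fin 4 → ℤ) (x z : Fin 4 → ℤ) (a b : Fib 3) :
    (∑ v ∈ box 4 Lc, divV F ((Lc : ℤ) • Y + toSite v)) x z a b =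
      ∑ v ∈ box (3 + 1) Lc, ∑ κ : Fin (3 + 1), (F κ ((Lc : ℤ) • Y + toSite v - unitVec κ) x z a b - F κ ((Lc : ℤ) • Y + toSite v) x z a b) := by
  simp only [KernelWard.divV, Finset.sum_apply, Pi.sub_apply]

/-- [folklore] The gauge-rotation symbol (sum of leg indicators) on a field leg: `Σ_v [x = y_v]`. -/
theorem legSum_inl (s : Finset (Fin (3 + 1) → ℕ)) (Y : Fin (3 + 1) → ℤ) (x : Fin (3 + 1) → ℤ) (β : Fin (3 + 1)) :
    (∑ v ∈ s, legInd (toSite (ctrOff 4 Lc)) ((Lc : ℤ) • Y + toSite v)) x (Sum.inl β) =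
      ∑ v ∈ s, (if x = (Lc : ℤ) • Y + toSite v then (1 : ℝ) else 0) := by
  simp only [Finset.sum_apply, legInd_inl]

/-- [folklore] The gauge-rotation symbol on a multiplier leg: `Σ_v [z + ρ_c = y_v]`. -/
theorem legSum_inr (s : Finset (Fin (3 + 1) → ℕ)) (Y : Fin (3 + 1) → ℤ) (z : Fin (3 + 1) → ℤ) (m : Fin (3 + 1)) :
    (∑ v ∈ s, legInd (toSite (ctrOff 4 Lc)) ((Lc : ℤ) • Y + toSite v)) z (Sum.inr m) =
      ∑ v ∈ s, (if z + toSite (ctrOff 4 Lc) = (Lc : ℤ) • Y + toSite v then (1 : ℝ) else 0) := by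
  simp only [Finset.sum_apply, legInd_inr]

/-! ## §2 The border Ward letter in the first jet slot -/

/-- [folklore] **`hBord0` FROM THE BOND-LEVEL WARD IDENTITY** (K-Q's binder token for token, any weight `cB`).  HYPOTHESIS `hW` (field–multiplier
entries; `Ssym` written out): for all `Y κ′ u′ x z β m` with `off Lc z = 0`,
`(stepScale 3 Lc 0 · Lc⁴)⁻¹ · Σ_v Σ_κ (cB·½(s(f;(κ,y_v−e_κ),h) + s(f;h,(κ,y_v−e_κ))) − cB·½(s(f;(κ,y_v),h) + s(f;h,(κ,y_v))))
   = cVH·m_b(f,h)·(½Σ_v[z + ρ_c = y_v]) − (½Σ_v[x = y_v])·cVH·m_b(f,h)`. -/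
theorem hBord0_of_bondWard (cB : ℝ)
    (hW : ∀ (Y : Fin 4 → ℤ) (κ' : Fin 4) (u' x z : Fin 4 → ℤ) (β m : Fin 4), off Lc z = 0 →
      (stepScale 3 Lc 0 * (Lc : ℝ) ^ (3 + 1))⁻¹ *
          ∑ v ∈ box (3 + 1) Lc, ∑ κ : Fin (3 + 1),
            (cB * ((1 / 2 : ℝ) * (vh2KerAt (toSite (ctrOff 4 Lc)) Lc m (blk Lc z) (β, x) (κ, (Lc : ℤ) • Y + toSite v - unitVec κ) (κ', u')
                + vh2KerAt (toSite (ctrOff 4 Lc)) Lc m (blk Lc z) (β, x) (κ', u') (κ, (Lc : ℤ) • Y + toSite v - unitVec κ)))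
              - cB * ((1 / 2 : ℝ) * (vh2KerAt (toSite (ctrOff 4 Lc)) Lc m (blk Lc z) (β, x) (κ, (Lc : ℤ) • Y + toSite v) (κ', u')
                + vh2KerAt (toSite (ctrOff 4 Lc)) Lc m (blk Lc z) (β, x) (κ', u') (κ, (Lc : ℤ) • Y + toSite v)))) =
        (-((Lc : ℝ) ^ (3 + 1) * (1 / 2) * (Lc : ℝ) ^ (3 + 1))) * vhKerAt (toSite (ctrOff 4 Lc)) Lc m (blk Lc z) (β, x) (κ', u')
            * ((1 / 2 : ℝ) * ∑ v ∈ box (3 + 1) Lc, (if z + toSite (ctrOff 4 Lc) = (Lc : ℤ) • Y + toSite v then (1 : ℝ) else 0))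
          - ((1 / 2 : ℝ) * ∑ v ∈ box (3 + 1) Lc, (if x = (Lc : ℤ) • Y + toSite v then (1 : ℝ) else 0))
            * ((-((Lc : ℝ) ^ (3 + 1) * (1 / 2) * (Lc : ℝ) ^ (3 + 1))) * vhKerAt (toSite (ctrOff 4 Lc)) Lc m (blk Lc z) (β, x) (κ', u'))) :
    ∀ (Y : Fin (3 + 1) → ℤ) (κ' : Fin (3 + 1)) (u' : Fin (3 + 1) → ℤ),
      (stepScale 3 Lc 0 * (Lc : ℝ) ^ (3 + 1))⁻¹ • ∑ v ∈ box (3 + 1) Lc, divV (fun κ u => cB • vh₂SAn1 Lc κ u κ' u') ((Lc : ℤ) • Y + toSite v) =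
        comp ((-((Lc : ℝ) ^ (3 + 1) * (1 / 2) * (Lc : ℝ) ^ (3 + 1))) • vhSAt (toSite (ctrOff 4 Lc)) 3 Lc rfl κ' u')
            (diagK (((1 : ℝ) / 2) • ∑ v ∈ box (3 + 1) Lc, legInd (toSite (ctrOff 4 Lc)) ((Lc : ℤ) • Y + toSite v)))
          - comp (diagK (((1 : ℝ) / 2) • ∑ v ∈ box (3 + 1) Lc, legInd (toSite (ctrOff 4 Lc)) ((Lc : ℤ) • Y + toSite v)))
            ((-((Lc : ℝ) ^ (3 + 1) * (1 / 2) * (Lc : ℝ) ^ (3 + 1))) • vhSAt (toSite (ctrOff 4 Lc)) 3 Lc rfl κ' u') := by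
  intro Y κ' u'
  funext x z a b
  rw [Pi.smul_apply, Pi.smul_apply, Pi.smul_apply, Pi.smul_apply, smul_eq_mul, divV_sum_apply, Pi.sub_apply, Pi.sub_apply, Pi.sub_apply,
    Pi.sub_apply, comp_diagK_right, comp_diagK_left, Pi.smul_apply, Pi.smul_apply, Pi.smul_apply, Pi.smul_apply, smul_eq_mul]
  rcases a with β | m₀ <;> rcases b with β' | m
  · -- (inl, inl): everything vanishes
    simp only [Pi.smul_apply, smul_eq_mul, vh₂SAn1_inl_inl, mul_zero, sub_self, Finset.sum_const_zero]
    unfold vhSAt; rw [packVH_inl_inl]; ring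
  · -- (inl β, inr m): the displayed identity
    simp only [Pi.smul_apply, smul_eq_mul, vh₂SAn1_inl_inr, vhSAt_inl_inr']
    rw [legSum_inl, legSum_inr]
    by_cases hz : off Lc z = 0
    · simp only [hz, if_true]
      exact hW Y κ' u' x z β m hz
    · simp only [hz, if_false, mul_zero, sub_self, Finset.sum_const_zero, zero_mul]
  · -- (inr m₀, inl β'): the anti-twin ∕ twin mirror of the displayed identity at (z, x)
    simp only [Pi.smul_apply, smul_eq_mul, vh₂SAn1_antiTwin, vh₂SAn1_inl_inr]
    rw [vhSAt_symm, vhSAt_inl_inr', legSum_inl, legSum_inr]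
    by_cases hx : off Lc x = 0
    · simp only [hx, if_true]
      have h := hW Y κ' u' z x β' m₀ hx
      simp only [Finset.sum_sub_distrib, Finset.sum_add_distrib, Finset.sum_neg_distrib, ← Finset.mul_sum, mul_add, mul_neg,
        neg_add] at h ⊢
      linear_combination -h
    · simp only [hx, if_false, mul_zero, neg_zero, sub_self, Finset.sum_const_zero, zero_mul]
  · -- (inr, inr): everything vanishes
    simp only [Pi.smul_apply, smul_eq_mul, vh₂SAn1_inr_inr, mul_zero, sub_self, Finset.sum_const_zero]
    unfold vhSAt; rw [packVH_inr_inr]; ring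

/-! ## §3 The border Ward letter in the second jet slot -/

/-- [folklore] **`hBord0''` FROM THE SAME BOND-LEVEL WARD IDENTITY**: the candidate is symmetric in its two jet bonds (`vh₂SAn1_swap`), so the
second-slot letter is the first-slot letter with the bonds renamed (K-Q's binder token for token). -/
theorem hBord0''_of_bondWard (cB : ℝ)
    (hW : ∀ (Y : Fin 4 → ℤ) (κ' : Fin 4) (u' x z : Fin 4 → ℤ) (β m : Fin 4), off Lc z = 0 →
      (stepScale 3 Lc 0 * (Lc : ℝ) ^ (3 + 1))⁻¹ *
          ∑ v ∈ box (3 + 1) Lc, ∑ κ : Fin (3 + 1),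
            (cB * ((1 / 2 : ℝ) * (vh2KerAt (toSite (ctrOff 4 Lc)) Lc m (blk Lc z) (β, x) (κ, (Lc : ℤ) • Y + toSite v - unitVec κ) (κ', u')
                + vh2KerAt (toSite (ctrOff 4 Lc)) Lc m (blk Lc z) (β, x) (κ', u') (κ, (Lc : ℤ) • Y + toSite v - unitVec κ)))
              - cB * ((1 / 2 : ℝ) * (vh2KerAt (toSite (ctrOff 4 Lc)) Lc m (blk Lc z) (β, x) (κ, (Lc : ℤ) • Y + toSite v) (κ', u')
                + vh2KerAt (toSite (ctrOff 4 Lc)) Lc m (blk Lc z) (β, x) (κ', u') (κ, (Lc : ℤ) • Y + toSite v)))) =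
        (-((Lc : ℝ) ^ (3 + 1) * (1 / 2) * (Lc : ℝ) ^ (3 + 1))) * vhKerAt (toSite (ctrOff 4 Lc)) Lc m (blk Lc z) (β, x) (κ', u')
            * ((1 / 2 : ℝ) * ∑ v ∈ box (3 + 1) Lc, (if z + toSite (ctrOff 4 Lc) = (Lc : ℤ) • Y + toSite v then (1 : ℝ) else 0))
          - ((1 / 2 : ℝ) * ∑ v ∈ box (3 + 1) Lc, (if x = (Lc : ℤ) • Y + toSite v then (1 : ℝ) else 0))
            * ((-((Lc : ℝ) ^ (3 + 1) * (1 / 2) * (Lc : ℝ) ^ (3 + 1))) * vhKerAt (toSite (ctrOff 4 Lc)) Lc m (blk Lc z) (β, x) (κ', u'))) :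
    ∀ (Y : Fin (3 + 1) → ℤ) (κ : Fin (3 + 1)) (u : Fin (3 + 1) → ℤ),
      (stepScale 3 Lc 0 * (Lc : ℝ) ^ (3 + 1))⁻¹ • ∑ v ∈ box (3 + 1) Lc, divV (fun κ' u' => cB • vh₂SAn1 Lc κ u κ' u') ((Lc : ℤ) • Y + toSite v) =
        comp ((-((Lc : ℝ) ^ (3 + 1) * (1 / 2) * (Lc : ℝ) ^ (3 + 1))) • vhSAt (toSite (ctrOff 4 Lc)) 3 Lc rfl κ u)
            (diagK (((1 : ℝ) / 2) • ∑ v ∈ box (3 + 1) Lc, legInd (toSite (ctrOff 4 Lc)) ((Lc : ℤ) • Y + toSite v)))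
          - comp (diagK (((1 : ℝ) / 2) • ∑ v ∈ box (3 + 1) Lc, legInd (toSite (ctrOff 4 Lc)) ((Lc : ℤ) • Y + toSite v)))
            ((-((Lc : ℝ) ^ (3 + 1) * (1 / 2) * (Lc : ℝ) ^ (3 + 1))) • vhSAt (toSite (ctrOff 4 Lc)) 3 Lc rfl κ u) := by
  intro Y κ u
  have e : (fun κ' u' => cB • vh₂SAn1 Lc κ u κ' u') = fun κ' u' => cB • vh₂SAn1 Lc κ' u' κ u := by
    funext κ' u'; rw [vh₂SAn1_swap]
  rw [e]
  exact hBord0_of_bondWard cB hW Y κ u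

/-! ## §4 The mixed Ward letter -/

/-- [folklore] **`hM₂0` FROM THE BOND-LEVEL MIXED WARD IDENTITY** (K-Q's binder token for token; weights `wM2 3 Lc 0 = wM1 3 Lc 0 = 1` kept as
tokens).  HYPOTHESES: `hWm` — the field–field scalar identity with the residual's ff entries; `hR₁ hR₂ hR₃` — the residual `RW₀` has no
other blocks (both sides of the letter are field–field supported). -/
theorem hM₂0_of_bondWard (cΛ : ℝ) (RW₀ : (Fin (3 + 1) → ℤ) → Fin (3 + 1) → (Fin (3 + 1) → ℤ) → MKer (3 + 1) (Fib 3))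
    (hWm : ∀ (y : Fin 4 → ℤ) (ρ' : Fin 4) (w x z : Fin 4 → ℤ) (β β' : Fin 4),
      (stepScale 3 Lc 0 * (Lc : ℝ) ^ (3 + 1))⁻¹ *
          ∑ v ∈ box (3 + 1) Lc, ∑ κ : Fin (3 + 1),
            (wM2 3 Lc 0 * mixKerAt (toSite (ctrOff 4 Lc)) Lc ρ' w (κ, (Lc : ℤ) • y + toSite v - unitVec κ) (β, x) (β', z)
              - wM2 3 Lc 0 * mixKerAt (toSite (ctrOff 4 Lc)) Lc ρ' w (κ, (Lc : ℤ) • y + toSite v) (β, x) (β', z)) =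
        (cΛ * wM1 3 Lc 0) * hessKerAt (toSite (ctrOff 4 Lc)) Lc ρ' w (β, x) (β', z)
            * ((1 / 2 : ℝ) * ∑ v ∈ box (3 + 1) Lc, (if z = (Lc : ℤ) • y + toSite v then (1 : ℝ) else 0))
          - ((1 / 2 : ℝ) * ∑ v ∈ box (3 + 1) Lc, (if x = (Lc : ℤ) • y + toSite v then (1 : ℝ) else 0))
            * ((cΛ * wM1 3 Lc 0) * hessKerAt (toSite (ctrOff 4 Lc)) Lc ρ' w (β, x) (β', z))
          + RW₀ y ρ' w x z (Sum.inl β) (Sum.inl β'))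
    (hR₁ : ∀ y ρ' w x z (β m : Fin 4), RW₀ y ρ' w x z (Sum.inl β) (Sum.inr m) = 0)
    (hR₂ : ∀ y ρ' w x z (m β : Fin 4), RW₀ y ρ' w x z (Sum.inr m) (Sum.inl β) = 0)
    (hR₃ : ∀ y ρ' w x z (m m' : Fin 4), RW₀ y ρ' w x z (Sum.inr m) (Sum.inr m') = 0) :
    ∀ (y : Fin (3 + 1) → ℤ) (ρ' : Fin (3 + 1)) (w : Fin (3 + 1) → ℤ),
      (stepScale 3 Lc 0 * (Lc : ℝ) ^ (3 + 1))⁻¹ • ∑ v ∈ box (3 + 1) Lc,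
          divV (fun κ u => M2Of 3 Lc (mixFFAt (toSite (ctrOff 4 Lc)) Lc) 0 κ u ρ' w) ((Lc : ℤ) • y + toSite v) =
        comp (M1At 3 Lc (toSite (ctrOff 4 Lc)) cΛ 0 ρ' w) (diagK (((1 : ℝ) / 2) • ∑ v ∈ box (3 + 1) Lc, legInd (toSite (ctrOff 4 Lc)) ((Lc : ℤ) • y + toSite v)))
          - comp (diagK (((1 : ℝ) / 2) • ∑ v ∈ box (3 + 1) Lc, legInd (toSite (ctrOff 4 Lc)) ((Lc : ℤ) • y + toSite v))) (M1At 3 Lc (toSite (ctrOff 4 Lc)) cΛ 0 ρ' w)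
          + RW₀ y ρ' w := by
  intro y ρ' w
  funext x z a b
  rw [Pi.smul_apply, Pi.smul_apply, Pi.smul_apply, Pi.smul_apply, smul_eq_mul, divV_sum_apply, Pi.add_apply, Pi.add_apply, Pi.add_apply,
    Pi.add_apply, Pi.sub_apply, Pi.sub_apply, Pi.sub_apply, Pi.sub_apply, comp_diagK_right, comp_diagK_left]
  simp only [M2Of, M1At, Pi.smul_apply, smul_eq_mul]
  rcases a with β | m <;> rcases b with β' | m'
  · rw [legSum_inl, legSum_inl]
    simp only [mixFFAt_inl_inl, hessFFAt_inl_inl]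
    exact hWm y ρ' w x z β β'
  · simp only [mixFFAt_inl_inr, hessFFAt_inl_inr, hR₁, mul_zero, zero_mul, sub_self, add_zero, Finset.sum_const_zero]
  · simp only [mixFFAt_inr, hessFFAt_inr, hR₂, mul_zero, zero_mul, sub_self, add_zero, Finset.sum_const_zero]
  · simp only [mixFFAt_inr, hessFFAt_inr, hR₃, mul_zero, zero_mul, sub_self, add_zero, Finset.sum_const_zero]

end

end Summit.QuantumFields.BalabanUV.Beta.WardLettersUnpacking
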